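import Summits.Schanuel.Schanuel.Theorems.RootDecomp1KHyper62

/-!
# RootDecomp1KHyper — lens 6, generation 17 «BILOG STAIRCASE CELL» (BilogStair.lean edition 4 d7e974ba…, 3617 l; §K–§M) — continuation (RootDecomp1KHyper63): §K `PB` («polynomially bounded in the height») closure lemmas, `pb_clash`, `natDegree_toPoly_le`, `piMeasure_fin1` (degree-explicit π-measure on `MvPolynomial (Fin 1) ℤ`), `caseII_outer_core` (one level of the twisted elimination; `maxHeartbeats 1600000` as in the source)

(lens-6 g17 `BilogStair.lean` EDITION 4, sha256 d7e974ba…2880, 3617 l, own farm rc 0 · 0 warn · 0 sorry · axioms std; §A–§J = edition 2 (ported as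
`RootDecomp1KHyper53`–`62`), §K appended in edition 3 (critic ACK STATUS L1751: additive, reshape rule respected, PORT may proceed; L1762),
§L–§M appended in edition 4 (NODE/EDITION4 L1765, statement diff 0 removed / 0 changed / 20 added); port by census-1 gen 16 in parts
`RootDecomp1KHyper63`–`66` — 63 = §K `PB` closure lemmas + `piMeasure_fin1` + `caseII_outer_core`, 64 = §K `caseII_outer`, 65 = §L `InnerNormII` /
`ZeroTransferII` (Prop defs, typed pieces) + `transferII_of_pieces` (PROVED), 66 = §M `zeroTransferII_holds` (PROVED) + `transferII_of_innerNorm`.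
PORT edits: the source's `one_le_mvlen_of_ne_zero` is the tree's `RootDecomp1KHyper03.one_le_mvlen` (deleted, two call sites re-pointed);
`le_exp_self'` / `transcendental_pi_complex` / `exists_aeval_ne_zero` private (generic one-liners with tree twins; per-part private copies);
eleven one-line docstrings added; `set_option linter.dupNamespace false` dropped; statements and proofs otherwise verbatim.
INSTRUMENTS of record, NO credit (critic L1751/L1763: TransferI/TransferII remain typed UNDECIDED; TransferII proved as typed = one theorem credit).
`--supports stmt-Schanuel-33363`; nothing here proves Schanuel; rung 0.)
-/

open Complex Polynomial IntermediateField Filter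
open scoped BigOperators

namespace Summit.Schanuel.Schanuel.Theorems.RootDecomp1KHyper

namespace HyperCell

namespace LatCell

namespace Bilog

variable {n : ℕ}
open Summit.Schanuel.Schanuel.Theorems.RootDecomp1KRelLiouvilleCell (mvPolyMeasure_one_of_polyMeasure ycoeff
  mvaeval_cons_eq_sum mvlen_ycoeff_le natDegree_finSuccEquiv_le_totalDegree norm_mvaeval_le_mvlen_mul_pow)

/-- Norm of a product over a multiset with factors of norm `≤ b`. -/
private theorem norm_multiset_prod_map_le (s : Multiset ℂ) (g : ℂ → ℂ) {b : ℝ} (hb : 0 ≤ b)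
    (h : ∀ r ∈ s, ‖g r‖ ≤ b) : ‖(s.map g).prod‖ ≤ b ^ Multiset.card s := by
  induction s using Multiset.induction_on with
  | empty => simp
  | cons a s ih =>
    rw [Multiset.map_cons, Multiset.prod_cons, Multiset.card_cons, pow_succ, norm_mul, mul_comm]
    exact mul_le_mul (ih fun r hr => h r (Multiset.mem_cons_of_mem hr)) (h a (Multiset.mem_cons_self a s))
      (norm_nonneg _) (pow_nonneg hb _)

/-! ## §K  The twisted elimination with GROWING degree (outer half of TRANSFER II, DECIDED)

`PB a b F` («polynomially bounded in the height»): `F k ≤ H_k^c` eventually, `H_k = hgt a b k ≥ 3`.  The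
degree-explicit measure of `π` (tree-PROVED Nesterenko–Waldschmidt, `pi_measure`) transported to `MvPolynomial (Fin 1) ℤ`.
THEOREM `caseII_outer`: `Φ ≠ 0`, `Φ(π, ℓ) = 0`, `b_k > 0` eventually, `N_k ∈ ℤ[x₁,x₂] ∖ 0` of total degree `≤ H_k^c`
and length `≤ exp(H_k^c)` with `‖N_k(π, a_kπ + b_kℓ)‖ < exp(−H_k^m)` for every `m` (eventually) ⟹ eventually
`N_k(π, a_kπ + b_kρ) = 0` for some root `ρ` of `Φ(π, ·)`.  (`caseII_expFree` is morally the case `N_k = G`; the piece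
(II.exp) of TRANSFER II is the case `N_k = Res_T(minpoly γ_k, G(x₁, x₂, T))` — the inner norm, not built here.) -/

/-- Polynomially bounded in the height `H_k = hgt a b k` (eventually). -/
def PB (a b : ℕ → ℚ) (F : ℕ → ℝ) : Prop := ∃ c : ℕ, ∀ᶠ k in atTop, F k ≤ hgt a b k ^ c

/-- `x ≤ exp x`. -/
private theorem le_exp_self' (x : ℝ) : x ≤ Real.exp x := by linarith [Real.add_one_le_exp x]

/-- `PB` is downward closed under eventual domination. -/
theorem pb_of_le {a b : ℕ → ℚ} {F G : ℕ → ℝ} (hG : PB a b G) (h : ∀ᶠ k in atTop, F k ≤ G k) : PB a b F := by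
  obtain ⟨c, hc⟩ := hG
  exact ⟨c, (h.and hc).mono fun k hk => hk.1.trans hk.2⟩

/-- Constants are `PB`. -/
theorem pb_const {a b : ℕ → ℚ} (C : ℝ) : PB a b fun _ => C := by
  obtain ⟨M, hM⟩ := pow_unbounded_of_one_lt C (by norm_num : (1 : ℝ) < 3)
  refine ⟨M, Filter.Eventually.of_forall fun k => hM.le.trans ?_⟩
  exact pow_le_pow_left₀ (by norm_num) (three_le_hgt a b k) M

/-- Powers of the height are `PB`. -/
theorem pb_pow_hgt {a b : ℕ → ℚ} (p : ℕ) : PB a b fun k => hgt a b k ^ p :=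
  ⟨p, Filter.Eventually.of_forall fun _ => le_rfl⟩

/-- The height itself is `PB`. -/
theorem pb_hgt {a b : ℕ → ℚ} : PB a b fun k => hgt a b k :=
  ⟨1, Filter.Eventually.of_forall fun k => by rw [pow_one]⟩

/-- `PB` is closed under sums. -/
theorem pb_add {a b : ℕ → ℚ} {F G : ℕ → ℝ} (hF : PB a b F) (hG : PB a b G) : PB a b fun k => F k + G k := by
  obtain ⟨c, hc⟩ := hF
  obtain ⟨d, hd⟩ := hG
  refine ⟨max c d + 1, (hc.and hd).mono fun k hk => ?_⟩
  have h3 := three_le_hgt a b k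
  have h1 : (1 : ℝ) ≤ hgt a b k := by linarith
  have hc' : F k ≤ hgt a b k ^ max c d := hk.1.trans (pow_le_pow_right₀ h1 (le_max_left _ _))
  have hd' : G k ≤ hgt a b k ^ max c d := hk.2.trans (pow_le_pow_right₀ h1 (le_max_right _ _))
  have hp : 0 ≤ hgt a b k ^ max c d := by positivity
  calc F k + G k ≤ 2 * hgt a b k ^ max c d := by linarith
    _ ≤ hgt a b k * hgt a b k ^ max c d := by nlinarith
    _ = hgt a b k ^ (max c d + 1) := by ring

/-- `PB` is closed under products of eventually non-negative functions. -/
theorem pb_mul {a b : ℕ → ℚ} {F G : ℕ → ℝ} (hF : PB a b F) (hG : PB a b G) (hF0 : ∀ᶠ k in atTop, 0 ≤ F k)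
    (hG0 : ∀ᶠ k in atTop, 0 ≤ G k) : PB a b fun k => F k * G k := by
  obtain ⟨c, hc⟩ := hF
  obtain ⟨d, hd⟩ := hG
  refine ⟨c + d, ((hc.and hd).and (hF0.and hG0)).mono fun k hk => ?_⟩
  obtain ⟨⟨h1, h2⟩, h3, h4⟩ := hk
  rw [pow_add]
  exact mul_le_mul h1 h2 h4 (le_trans h3 h1)

/-- `PB` is closed under `log` of an eventually non-negative function. -/
theorem pb_log {a b : ℕ → ℚ} {F : ℕ → ℝ} (hF : PB a b F) (hF0 : ∀ᶠ k in atTop, 0 ≤ F k) :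
    PB a b fun k => Real.log (F k) :=
  pb_of_le hF (hF0.mono fun _ hk => Real.log_le_self hk)

/-- The clash: a polynomially bounded exponent never beats hyper-smallness in the height. -/
theorem pb_clash {a b : ℕ → ℚ} {F ε : ℕ → ℝ} (hF : PB a b F)
    (hε : ∀ m : ℕ, ∀ᶠ k in atTop, ε k < Real.exp (-(hgt a b k) ^ m)) (hε0 : ∀ᶠ k in atTop, 0 ≤ ε k) :
    ∀ᶠ k in atTop, Real.exp (F k) * ε k < 1 := by
  obtain ⟨c, hc⟩ := hF
  filter_upwards [hc, hε (c + 1), hε0] with k hk hεk hε0k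
  have h3 := three_le_hgt a b k
  have hlt : F k < hgt a b k ^ (c + 1) := by
    have hpos : 0 < hgt a b k ^ c := by positivity
    calc F k ≤ hgt a b k ^ c := hk
      _ < hgt a b k ^ c * hgt a b k := by nlinarith
      _ = hgt a b k ^ (c + 1) := by ring
  calc Real.exp (F k) * ε k ≤ Real.exp (F k) * Real.exp (-(hgt a b k) ^ (c + 1)) := by gcongr
    _ = Real.exp (F k - hgt a b k ^ (c + 1)) := by rw [← Real.exp_add]; ring_nf
    _ < 1 := Real.exp_lt_one_iff.mpr (by linarith)

/-- `deg_{x₂} ≤ totalDegree`. -/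
theorem natDegree_toPoly_le (P : MvPolynomial (Fin 2) ℤ) : (toPoly P).natDegree ≤ P.totalDegree := by
  by_cases h : toPoly P = 0
  · rw [h, Polynomial.natDegree_zero]; exact Nat.zero_le _
  · have hc : (toPoly P).coeff (toPoly P).natDegree ≠ 0 := Polynomial.leadingCoeff_ne_zero.mpr h
    have := totalDegree_toPoly_coeff_add_le P _ hc
    omega

/-- The degree-explicit Nesterenko–Waldschmidt measure of `π` for `P ∈ ℤ[x₁]` as an `MvPolynomial (Fin 1) ℤ`
(tree `pi_measure`; bookkeeping as in the tree's `mvPolyMeasure_one_of_polyMeasure`). -/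
theorem piMeasure_fin1 (P : MvPolynomial (Fin 1) ℤ) (hP : P ≠ 0) {d : ℕ} (hd : 1 ≤ d)
    (hdeg : P.totalDegree ≤ d) {Λ : ℝ} (hΛ : ((d : ℝ) + 1) * ((mvlen P : ℤ) : ℝ) + 3 ≤ Λ) :
    Real.exp (-(2 * 10 ^ 6 * (d : ℝ) * (Real.log Λ + d * Real.log d) * (1 + Real.log d))) ≤
      ‖MvPolynomial.aeval ![(Real.pi : ℂ)] P‖ := by
  classical
  set K : ℕ := (MvPolynomial.finSuccEquiv ℤ 0 P).natDegree with hKdef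
  have hKd : K ≤ d := (natDegree_finSuccEquiv_le_totalDegree P).trans hdeg
  set a : ℕ → ℤ := fun k => MvPolynomial.coeff 0 (ycoeff P k) with hadef
  have hyc : ∀ k, ycoeff P k = MvPolynomial.C (a k) := fun k => MvPolynomial.eq_C_of_isEmpty _
  set p : ℤ[X] := Polynomial.map (MvPolynomial.constantCoeff : MvPolynomial (Fin 0) ℤ →+* ℤ)
    (MvPolynomial.finSuccEquiv ℤ 0 P) with hpdef
  have hpcoeff : ∀ k, p.coeff k = a k := fun k => by
    rw [hpdef, Polynomial.coeff_map, MvPolynomial.constantCoeff_eq]; rfl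
  have hpK : p.natDegree ≤ K := by rw [hpdef]; exact Polynomial.natDegree_map_le
  have haK : a K ≠ 0 := by
    intro h0
    have hne : MvPolynomial.finSuccEquiv ℤ 0 P ≠ 0 := (EmbeddingLike.map_ne_zero_iff).mpr hP
    have h1 := Polynomial.leadingCoeff_ne_zero.mpr hne
    rw [Polynomial.leadingCoeff] at h1
    have h2 : ycoeff P K = 0 := by rw [hyc, h0, MvPolynomial.C_0]
    exact h1 h2
  have hp0 : p ≠ 0 := fun h => haK (by rw [← hpcoeff, h, Polynomial.coeff_zero])
  have heval : Polynomial.aeval (Real.pi : ℂ) p = MvPolynomial.aeval (![(Real.pi : ℂ)] : Fin 1 → ℂ) P := by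
    have e1 : (![(Real.pi : ℂ)] : Fin 1 → ℂ) = Fin.cons (Real.pi : ℂ) (![] : Fin 0 → ℂ) := rfl
    rw [e1, mvaeval_cons_eq_sum P _ (Real.pi : ℂ) le_rfl,
      Polynomial.aeval_eq_sum_range' (Nat.lt_succ_of_le hpK)]
    refine Finset.sum_congr rfl fun k _ => ?_
    rw [hpcoeff, hyc, MvPolynomial.aeval_C, zsmul_eq_mul, algebraMap_int_eq, eq_intCast]
  have hlenZ : len p ≤ ((d + 1 : ℕ) : ℤ) * mvlen P := by
    calc len p ≤ ∑ k ∈ Finset.range (K + 1), |p.coeff k| := len_le_of_natDegree_le p hpK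
      _ ≤ ∑ _k ∈ Finset.range (K + 1), mvlen P := by
          refine Finset.sum_le_sum fun k _ => ?_
          rw [hpcoeff, hadef]
          exact (abs_coeff_le_mvlen _ _).trans (mvlen_ycoeff_le P k)
      _ = ((K + 1 : ℕ) : ℤ) * mvlen P := by rw [Finset.sum_const, Finset.card_range, nsmul_eq_mul]
      _ ≤ ((d + 1 : ℕ) : ℤ) * mvlen P :=
          mul_le_mul_of_nonneg_right (by exact_mod_cast Nat.succ_le_succ hKd) (mvlen_nonneg P)
  have hlen : ((len p : ℤ) : ℝ) + 3 ≤ Λ := by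
    have h : ((len p : ℤ) : ℝ) ≤ ((((d + 1 : ℕ) : ℤ) * mvlen P : ℤ) : ℝ) := by exact_mod_cast hlenZ
    push_cast at h
    linarith
  have h1 := pi_measure p hp0 hd (hpK.trans hKd) hlen
  rwa [heval] at h1

set_option maxHeartbeats 1600000 in
/-- **Core of the twisted elimination, one level `k`.**  For `Φ ≠ 0` with `Φ(π, ℓ) = 0` there are constants
`C₁ ≥ 0`, `C₂ ≥ 1` (depending on `Φ` only) such that for every `k` with `b_k > 0` and every `N ≠ 0 ∈ ℤ[x₁,x₂]`:
EITHER `N(π, a_kπ + b_kρ) = 0` for a root `ρ` of `Φ(π,·)`, OR the eliminant `R = Res_{x₂}(Φ̃_k, N) ∈ ℤ[x₁]` is non-zero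
and `‖R(π)‖ ≤ (C₁ H_k^{2E_Φ})^K · (mvlen N · (C₂H_k)^{deg N})^{E_Φ} · ‖N(π, a_kπ + b_kℓ)‖`. -/
theorem caseII_outer_core {ℓ : ℝ} {a b : ℕ → ℚ} (Φ : MvPolynomial (Fin 2) ℤ) (hΦ : Φ ≠ 0)
    (hΦ0 : MvPolynomial.aeval ![(Real.pi : ℂ), (ℓ : ℂ)] Φ = 0) :
    ∃ C₁ C₂ : ℝ, 0 ≤ C₁ ∧ 1 ≤ C₂ ∧ ∀ k : ℕ, 0 < b k → ∀ N : MvPolynomial (Fin 2) ℤ, N ≠ 0 →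
      (∃ ρ : ℂ, MvPolynomial.aeval ![(Real.pi : ℂ), ρ] Φ = 0 ∧
        MvPolynomial.aeval ![(Real.pi : ℂ), (a k : ℂ) * Real.pi + (b k : ℂ) * ρ] N = 0) ∨
      (resII Φ N ((a k).num * (b k).den) ((b k).num * (a k).den) ((a k).den * (b k).den) ≠ 0 ∧
        ‖MvPolynomial.aeval ![(Real.pi : ℂ)]
            (resII Φ N ((a k).num * (b k).den) ((b k).num * (a k).den) ((a k).den * (b k).den))‖ ≤
          (C₁ * hgt a b k ^ (2 * (toPoly Φ).natDegree)) ^ (toPoly N).natDegree *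
            ((((mvlen N : ℤ)) : ℝ) * (C₂ * hgt a b k) ^ N.totalDegree) ^ (toPoly Φ).natDegree *
            ‖MvPolynomial.aeval ![(Real.pi : ℂ), (a k : ℂ) * Real.pi + (b k : ℂ) * ℓ] N‖) := by
  classical
  set φ : MvPolynomial (Fin 1) ℤ →+* ℂ := (MvPolynomial.aeval ![(Real.pi : ℂ)]).toRingHom with hφ
  have hφa : ∀ Q, φ Q = MvPolynomial.aeval ![(Real.pi : ℂ)] Q := fun Q => rfl
  set EΦ := (toPoly Φ).natDegree with hEΦ
  set pC : ℂ[X] := (toPoly Φ).map φ with hpC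
  have hpC_eval : ∀ t, pC.eval t = MvPolynomial.aeval ![(Real.pi : ℂ), t] Φ := fun t => eval_map_toPoly Φ _ t
  have hpC0 : pC ≠ 0 := by
    intro h0
    have h1 : pC.coeff EΦ = φ ((toPoly Φ).coeff EΦ) := Polynomial.coeff_map _ _
    rw [h0, Polynomial.coeff_zero] at h1
    exact aeval_pi_ne_zero (Polynomial.leadingCoeff_ne_zero.mpr (toPoly_ne_zero hΦ)) h1.symm
  set RΦ : ℝ := 1 + (pC.roots.map fun r => ‖r‖).sum with hRΦ
  have hRΦroot : ∀ ρ ∈ pC.roots, ‖ρ‖ ≤ RΦ := by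
    intro ρ hρ
    have hnn : ∀ x ∈ pC.roots.map (fun r => ‖r‖), (0 : ℝ) ≤ x := by
      intro x hx
      obtain ⟨r, _, rfl⟩ := Multiset.mem_map.mp hx
      exact norm_nonneg _
    have h1 : ‖ρ‖ ≤ (pC.roots.map fun r => ‖r‖).sum :=
      Multiset.single_le_sum hnn _ (Multiset.mem_map_of_mem _ hρ)
    linarith
  have hRΦ0 : 0 ≤ RΦ := by
    have : 0 ≤ (pC.roots.map fun r => ‖r‖).sum :=
      Multiset.sum_nonneg fun x hx => by
        obtain ⟨r, _, rfl⟩ := Multiset.mem_map.mp hx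
        exact norm_nonneg _
    linarith
  set cE : ℂ := φ ((toPoly Φ).coeff EΦ) with hcE
  have hcE0 : cE ≠ 0 := aeval_lcoeff_ne_zero Φ hΦ
  obtain ⟨cΛ, hcΛ⟩ : ∃ cΛ : ℝ, cΛ = Real.pi + RΦ + 1 := ⟨_, rfl⟩
  have hcΛ1 : 1 ≤ cΛ := by rw [hcΛ]; linarith [Real.pi_pos]
  have hcΛ0 : 0 ≤ cΛ := by linarith
  have hπcΛ : Real.pi ≤ cΛ := by rw [hcΛ]; linarith
  refine ⟨‖cE‖, cΛ, norm_nonneg _, hcΛ1, fun k hbk N hN => ?_⟩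
  -- the data of step `k`
  obtain ⟨H, hH⟩ : ∃ H : ℝ, H = hgt a b k := ⟨_, rfl⟩
  rw [← hH]
  have hH3 : 3 ≤ H := hH ▸ three_le_hgt a b k
  have hH1 : 1 ≤ H := by linarith
  have hH0 : 0 < H := by linarith
  obtain ⟨A, hA⟩ : ∃ A : ℤ, A = (a k).num * (b k).den := ⟨_, rfl⟩
  obtain ⟨B, hB⟩ : ∃ B : ℤ, B = (b k).num * (a k).den := ⟨_, rfl⟩
  obtain ⟨E, hE⟩ : ∃ E : ℕ, E = (a k).den * (b k).den := ⟨_, rfl⟩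
  rw [← hA, ← hB, ← hE]
  have hE0 : E ≠ 0 := by rw [hE]; exact Nat.mul_ne_zero (a k).den_nz (b k).den_nz
  have hEC : ((E : ℤ) : ℂ) ≠ 0 := by exact_mod_cast hE0
  have hEa : ((E : ℤ) : ℂ) * (a k : ℂ) = (A : ℂ) := by
    rw [hE, hA, Rat.cast_def]
    have : ((a k).den : ℂ) ≠ 0 := by exact_mod_cast (a k).den_nz
    field_simp
    push_cast
    ring
  have hEb : ((E : ℤ) : ℂ) * (b k : ℂ) = (B : ℂ) := by
    rw [hE, hB, Rat.cast_def]
    have : ((b k).den : ℂ) ≠ 0 := by exact_mod_cast (b k).den_nz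
    field_simp
    push_cast
    ring
  have hBC : (B : ℂ) ≠ 0 := by
    rw [hB]; push_cast
    exact mul_ne_zero (by exact_mod_cast (Rat.num_pos.mpr hbk).ne') (by exact_mod_cast (a k).den_nz)
  have hEH : ((E : ℤ) : ℝ) ≤ H ^ 2 := by
    have := den_mul_den_le_hgt_sq a b k
    rw [hE, hH]; push_cast at this ⊢; exact this
  have haH : |(a k : ℝ)| ≤ H := by rw [hH]; exact (abs_cast_le_hgt a b k).1
  have hbH : |(b k : ℝ)| ≤ H := by rw [hH]; exact (abs_cast_le_hgt a b k).2
  -- `gN = N(π, ·)`, `f = Φ̃_k(π, ·)`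
  set K := (toPoly N).natDegree with hK
  set gN : ℂ[X] := (toPoly N).map φ with hgN
  have hgN_eval : ∀ t, gN.eval t = MvPolynomial.aeval ![(Real.pi : ℂ), t] N := fun t => eval_map_toPoly N _ t
  set r : ℂ := (a k : ℂ) * (Real.pi : ℂ) + (b k : ℂ) * (ℓ : ℂ) with hr
  set f : ℂ[X] := (toPoly (twist Φ A B E)).map φ with hf
  have hf_eval : ∀ t, f.eval t = MvPolynomial.aeval ![(Real.pi : ℂ), t] (twist Φ A B E) :=
    fun t => eval_map_toPoly _ _ t
  obtain ⟨hfdeg, hflc⟩ := natDegree_leadingCoeff_ftwist Φ hΦ A B E hE0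
  rw [← hf] at hfdeg hflc
  have hlc0 : f.leadingCoeff ≠ 0 := by
    rw [hflc]; exact mul_ne_zero hcE0 (pow_ne_zero _ hEC)
  have hf0 : f ≠ 0 := fun h0 => hlc0 (by rw [h0, Polynomial.leadingCoeff_zero])
  have hfr : f.eval r = 0 := by
    rw [hf_eval, aeval_twist_of_eq Φ A B E (ρ := (ℓ : ℂ))
      (by rw [hr, mul_add, ← mul_assoc, ← mul_assoc, hEa, hEb]; ring), hΦ0, mul_zero]
  have hr_mem : r ∈ f.roots := (Polynomial.mem_roots hf0).mpr hfr
  have hroots : ∀ r' ∈ f.roots, ∃ ρ' ∈ pC.roots, r' = (a k : ℂ) * Real.pi + (b k : ℂ) * ρ' := by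
    intro r' hr'
    have h0 : f.eval r' = 0 := (Polynomial.mem_roots hf0).mp hr'
    set ρ' : ℂ := (((E : ℤ) : ℂ) * r' - (A : ℂ) * Real.pi) / (B : ℂ) with hρ'
    have hrel : ((E : ℤ) : ℂ) * r' - (A : ℂ) * Real.pi = (B : ℂ) * ρ' := by
      rw [hρ', mul_div_cancel₀ _ hBC]
    rw [hf_eval, aeval_twist_of_eq Φ A B E hrel] at h0
    have hΦρ : MvPolynomial.aeval ![(Real.pi : ℂ), ρ'] Φ = 0 :=
      (mul_eq_zero.mp h0).resolve_left (pow_ne_zero _ hBC)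
    refine ⟨ρ', (Polynomial.mem_roots hpC0).mpr (by rw [Polynomial.IsRoot.def, hpC_eval]; exact hΦρ), ?_⟩
    have ha' : (a k : ℂ) = (A : ℂ) / ((E : ℤ) : ℂ) := by rw [← hEa, mul_div_cancel_left₀ _ hEC]
    have hb' : (b k : ℂ) = (B : ℂ) / ((E : ℤ) : ℂ) := by rw [← hEb, mul_div_cancel_left₀ _ hEC]
    rw [ha', hb']
    field_simp
    linear_combination hrel
  have hroot_norm : ∀ r' ∈ f.roots, ‖r'‖ ≤ H * cΛ := by
    intro r' hr'
    obtain ⟨ρ', hρ', rfl⟩ := hroots r' hr'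
    calc ‖(a k : ℂ) * Real.pi + (b k : ℂ) * ρ'‖ ≤ ‖(a k : ℂ) * Real.pi‖ + ‖(b k : ℂ) * ρ'‖ := norm_add_le _ _
      _ = |(a k : ℝ)| * Real.pi + |(b k : ℝ)| * ‖ρ'‖ := by
          rw [norm_mul, norm_mul, show ((a k : ℚ) : ℂ) = ((a k : ℝ) : ℂ) by push_cast; rfl,
            show ((b k : ℚ) : ℂ) = ((b k : ℝ) : ℂ) by push_cast; rfl, Complex.norm_real, Complex.norm_real,
            Complex.norm_real, Real.norm_eq_abs, Real.norm_eq_abs, Real.norm_eq_abs, abs_of_pos Real.pi_pos]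
      _ ≤ H * Real.pi + H * RΦ := add_le_add (mul_le_mul_of_nonneg_right haH Real.pi_pos.le)
          (mul_le_mul hbH (hRΦroot ρ' hρ') (norm_nonneg _) (by linarith))
      _ ≤ H * cΛ := by rw [hcΛ]; nlinarith
  have hHc1 : 1 ≤ H * cΛ := by nlinarith
  have hπH : Real.pi ≤ H * cΛ := by nlinarith [Real.pi_pos]
  -- the values `N(π, r')` at the roots
  have hg_val : ∀ r' ∈ f.roots, ‖gN.eval r'‖ ≤ ((mvlen N : ℤ) : ℝ) * (H * cΛ) ^ N.totalDegree := by
    intro r' hr'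
    rw [hgN_eval]
    refine norm_mvaeval_le_mvlen_mul_pow N _ hHc1 (fun i => ?_) le_rfl
    match i with
    | 0 => simpa [abs_of_pos Real.pi_pos] using hπH
    | 1 => simpa using hroot_norm r' hr'
  have hres_eval := aeval_resII Φ hΦ N A B E hE0 f hf
  by_cases hres : resII Φ N A B E = 0
  · -- ZERO BRANCH
    left
    have hprod0 : (f.roots.map fun r => gN.eval r).prod = 0 := by
      have h1 := hres_eval
      rw [hres, map_zero] at h1
      exact (mul_eq_zero.mp h1.symm).resolve_left (pow_ne_zero _ hlc0)
    obtain ⟨r', hr', hgr'⟩ : ∃ r' ∈ f.roots, gN.eval r' = 0 := by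
      have h0 : (0 : ℂ) ∈ f.roots.map (fun r => gN.eval r) := Multiset.prod_eq_zero_iff.mp hprod0
      obtain ⟨r', hr', h⟩ := Multiset.mem_map.mp h0
      exact ⟨r', hr', h⟩
    obtain ⟨ρ', hρ', hr'eq⟩ := hroots r' hr'
    refine ⟨ρ', ?_, ?_⟩
    · have := (Polynomial.mem_roots hpC0).mp hρ'
      rwa [Polynomial.IsRoot.def, hpC_eval] at this
    · rw [← hgN_eval, ← hr'eq]; exact hgr'
  · -- UPPER BOUND
    right
    refine ⟨hres, ?_⟩
    have hM1 : (1 : ℝ) ≤ ((mvlen N : ℤ) : ℝ) := by exact_mod_cast one_le_mvlen hN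
    rw [hres_eval, norm_mul, norm_pow, ← Multiset.cons_erase hr_mem, Multiset.map_cons, Multiset.prod_cons,
      norm_mul, hgN_eval r]
    have h1 : ‖f.leadingCoeff‖ ≤ ‖cE‖ * H ^ (2 * EΦ) := by
      rw [hflc, norm_mul, norm_pow, hcE, hφa, pow_mul]
      refine mul_le_mul_of_nonneg_left (pow_le_pow_left₀ (norm_nonneg _) ?_ _) (norm_nonneg _)
      rw [show ((E : ℤ) : ℂ) = (((E : ℤ) : ℝ) : ℂ) by push_cast; rfl, Complex.norm_real, Real.norm_eq_abs,
        abs_of_nonneg (by positivity)]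
      exact hEH
    have h2 : ‖((f.roots.erase r).map fun r => gN.eval r).prod‖ ≤
        (((mvlen N : ℤ) : ℝ) * (H * cΛ) ^ N.totalDegree) ^ EΦ := by
      refine (norm_multiset_prod_map_le _ _ (by positivity) fun r' hr' =>
        hg_val r' (Multiset.mem_of_mem_erase hr')).trans ?_
      refine pow_le_pow_right₀ ?_ ?_
      · have : 1 ≤ (H * cΛ) ^ N.totalDegree := one_le_pow₀ hHc1
        nlinarith
      · calc Multiset.card (f.roots.erase r) ≤ Multiset.card f.roots := Multiset.card_erase_le
          _ ≤ f.natDegree := Polynomial.card_roots' f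
          _ = EΦ := hfdeg
    calc ‖f.leadingCoeff‖ ^ K * (‖MvPolynomial.aeval ![(Real.pi : ℂ), r] N‖ *
          ‖((f.roots.erase r).map fun r => gN.eval r).prod‖)
        ≤ (‖cE‖ * H ^ (2 * EΦ)) ^ K * (‖MvPolynomial.aeval ![(Real.pi : ℂ), r] N‖ *
          (((mvlen N : ℤ) : ℝ) * (H * cΛ) ^ N.totalDegree) ^ EΦ) := by
          refine mul_le_mul (pow_le_pow_left₀ (norm_nonneg _) h1 K)
            (mul_le_mul_of_nonneg_left h2 (norm_nonneg _)) (by positivity) (by positivity)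
      _ = (‖cE‖ * H ^ (2 * EΦ)) ^ K * (((mvlen N : ℤ) : ℝ) * (cΛ * H) ^ N.totalDegree) ^ EΦ *
          ‖MvPolynomial.aeval ![(Real.pi : ℂ), r] N‖ := by ring

end Bilog
end LatCell
end HyperCell
end Summit.Schanuel.Schanuel.Theorems.RootDecomp1KHyper
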